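import Summits.NavierStokesRegularity.NavierStokesRegularity.Theorems.SoloRefuteSiche2026Series
import Summits.NavierStokesRegularity.NavierStokesRegularity.Theorems.SoloRefuteSiche2026Steps23
import Summits.NavierStokesRegularity.NavierStokesRegularity.Theorems.SoloRefuteSiche2026AxisField
import Summits.NavierStokesRegularity.NavierStokesRegularity.Theorems.SoloRefuteSiche2026Lattice
import HarnessLib

/-!
# C135 `Siche2026` — Theorem 6.28 (51) p. 22 is false for ONE smooth solution: `¬ Step4_globalDecoherence`

B. Siche, «Phase Decoherence and Regularity of the Three-Dimensional Navier–Stokes Equations», Zenodo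
10.5281/zenodo.19899171 v1.5 (2026). The decl of record `Literature.Claims.NS.Siche2026.Step4_globalDecoherence`
(the form CONSUMED by `claim_of_steps`) asserts, for EVERY smooth solution of (1) on `[0,T) × 𝕋³` with `ν > 0`,
a constant `C` with `χ_K(u(t))(0) ≤ C` for all `t ∈ (0,T)` and ALL shells `K`.

WITNESS (assembled from typist-10 g3's series block `SoloRefuteSiche2026Series` and the refuter-7 g2 kit):
the lacunary streamwise shear heat flow `u(t,x) = Σ_j e^{−5^j} e^{−4π²ν 25^j t} sin(2π 5^j x₀) ŷ`
(`Series.lacU ν T`, zero pressure, zero force — an exact smooth solution, `Series.isClassicalNSSolutionOn_lacU`).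
Its shell `K = 25^j` is carried by `±5^j e₀` only (`Series.eq_of_mem_lacSupp_of_sum_sq`), with `ŷ`-polarised
coefficients `∓(i/2) e^{−5^j} e^{−λt}` — a heat-decayed SINE profile — so in the typed gauge (39) all four helical
phases on the shell are ALIGNED and `χ_{25^j}(u(t))(0) = N_{25^j}` (`coherence_axis_zero_of_imaginary`), for every
`t` and every `j`; `N_{25^j} = 2·#S_{25^j} ≥ 2(j+1)` is unbounded (`exists_shell_card_gt`). Hence no `C` exists
(ν = 1, T = 2, t = 1).

WHAT THIS IS NOT: not a claim about NS regularity or blow-up; not a claim about any author beyond the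
typed locator.
-/

set_option linter.dupNamespace false

noncomputable section

open Literature.Analysis.FunctionSpaces Literature.Analysis.FunctionSpaces.Torus
open Literature.Claims.NS.Siche2026
open Set
open scoped ComplexConjugate

namespace Summit.NavierStokesRegularity.NavierStokesRegularity.Theorems.Siche2026

/-- typist-10's axis frequency is the kit's `kx`: `ax0 n = kx n = (n, 0, 0)`. [folklore] -/
theorem ax0_eq_kx (n : ℤ) : Series.ax0 n = kx n := by
  rw [Series.ax0_eq_vec]; rfl

/-- `β • e₁ = (0, β, 0) = yC β`. [folklore] -/
theorem smul_e1C_eq_yC (β : ℂ) : β • Series.e1C = yC β := by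
  rw [Series.smul_e1C_eq]; rfl

/-- a point of the shell `25^j` other than `±5^j e₀` is OFF the lacunary support. [folklore] -/
theorem not_mem_lacSupp_of_mem_shell {j : ℕ} {k : Z3} (hk : k ∈ shell (25 ^ j))
    (h1 : k ≠ kx ((5 : ℤ) ^ j)) (h2 : k ≠ -kx ((5 : ℤ) ^ j)) : k ∉ Series.lacSupp := by
  intro hmem
  have hsum : ∑ i, k i ^ 2 = (25 : ℤ) ^ j := by
    have := (mem_shell.1 hk)
    unfold latticeNormSq at this
    exact_mod_cast this
  rcases Series.eq_of_mem_lacSupp_of_sum_sq hmem hsum with h | h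
  · exact h1 (by rw [h, ax0_eq_kx])
  · exact h2 (by rw [h, ax0_eq_kx, ← neg_kx])

/-- the heat-decay factor of the mode `k` at time `t`. [folklore] -/
def decay (ν : ℝ) (k : Z3) (t : ℝ) : ℝ := Real.exp (-(4 * Real.pi ^ 2 * ν * freqNormSq k) * t)

/-- the decay factors at `±5^j e₀` agree. [folklore] -/
theorem decay_neg (ν : ℝ) (n : ℤ) (t : ℝ) : decay ν (Series.ax0 (-n)) t = decay ν (Series.ax0 n) t := by
  unfold decay; rw [Series.freqNormSq_ax0, Series.freqNormSq_ax0]; push_cast; rw [neg_sq]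

/-- **The typed coherence of the lacunary sine shear flow is MAXIMAL on every shell `25^j`, at every time**:
`χ_{25^j}(lacU ν T t)(0) = N_{25^j}` for `t ∈ [0, T]`. [cite: Siche2026, Definition 4.1 p. 7; Theorem 6.28 (51) p. 22] -/
theorem coherence_lacU {ν T t : ℝ} (hν : 0 < ν) (hT : 0 < T) (ht : t ∈ Icc 0 T) (j : ℕ) :
    coherence (Series.lacU ν T t) (25 ^ j) 0 = shellModes (25 ^ j) := by
  have hn : (0 : ℤ) < 5 ^ j := by positivity
  have hK := kx_five_pow_mem_shell j
  -- the common real amplitude `a = e^{−λt} e^{−5^j} > 0`; `β = −(i/2)·a = i·r`, `r = −a/2`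
  set a : ℝ := decay ν (Series.ax0 (5 ^ j)) t * Real.exp (-(5 : ℝ) ^ j) with ha
  have ha0 : 0 < a := by
    rw [ha]; unfold decay; exact mul_pos (Real.exp_pos _) (Real.exp_pos _)
  have hr : -(a / 2) ≠ 0 := by
    intro h; linarith
  have hp : coeff (Series.lacU ν T t) (kx ((5 : ℤ) ^ j)) = yC (Complex.I * ((-(a / 2) : ℝ) : ℂ)) := by
    unfold coeff
    rw [← ax0_eq_kx, Series.coeff_lacU hν hT ht, Series.lacCoeff_axis_pos, smul_smul, smul_e1C_eq_yC]
    congr 1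
    rw [ha]; unfold decay; push_cast; ring
  have hm : coeff (Series.lacU ν T t) (-kx ((5 : ℤ) ^ j)) =
      yC (conj (Complex.I * ((-(a / 2) : ℝ) : ℂ))) := by
    unfold coeff
    rw [neg_kx, ← ax0_eq_kx, Series.coeff_lacU hν hT ht, Series.lacCoeff_axis_neg, smul_smul,
      smul_e1C_eq_yC]
    congr 1
    have hd : decay ν (Series.ax0 (-(5 ^ j))) t = decay ν (Series.ax0 (5 ^ j)) t := decay_neg ν _ t
    rw [map_mul, Complex.conj_I, Complex.conj_ofReal, ha, ← hd]
    unfold decay; push_cast; ring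
  have h0 : ∀ k ∈ shell (25 ^ j), k ≠ kx ((5 : ℤ) ^ j) → k ≠ -kx ((5 : ℤ) ^ j) →
      coeff (Series.lacU ν T t) k = 0 := by
    intro k hk h1 h2
    unfold coeff
    exact Series.coeff_lacU_off hν hT ht (not_mem_lacSupp_of_mem_shell hk h1 h2)
  exact coherence_axis_zero_of_imaginary hn hK hr hp hm h0

/-- **Refutation of Step 4 in its per-solution form of record** (`Literature.Claims.NS.Siche2026.Step4_globalDecoherence`,
Theorem 6.28 (51) p. 22, «sup_{K ≥ 1} χ_K(t) = O(1) for all t > 0»): for the single smooth solution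
`Series.lacU 1 2` (lacunary sine shear heat flow, ν = 1, on `[0,2) × 𝕋³`, zero pressure) and `t = 1`,
`χ_{25^j}(u(1))(0) = N_{25^j} ≥ 2(j+1)` for every `j`, so `K ↦ χ_K(u(1))(0)` is unbounded and no constant `C`
exists. [cite: Siche2026, Theorem 6.28 (51) p. 22; Definition 4.1 p. 7] -/
theorem not_Step4_globalDecoherence : ¬ Step4_globalDecoherence := by
  intro h
  obtain ⟨C, hC⟩ := h 1 one_pos 2 (Series.lacU 1 2) (fun _ _ => 0)
    (Series.isClassicalNSSolutionOn_lacU one_pos two_pos)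
  obtain ⟨j, -, hj⟩ := exists_shell_card_gt C
  have h1 := hC 1 ⟨one_pos, one_lt_two⟩ (25 ^ j)
  rw [coherence_lacU one_pos two_pos ⟨zero_le_one, one_le_two⟩ j] at h1
  unfold shellModes at h1
  push_cast at h1
  linarith

end Summit.NavierStokesRegularity.NavierStokesRegularity.Theorems.Siche2026
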